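import Summits.MatrixMultiplication.OmegaCensus.STPPKneserFilter

/-!
# ω-census (abelian STPP census): representation counts, filter N9, and the fibre bound

HONEST FRAMING (pub-omega census; verbatim): lottery ticket; floor = certified bounds/negative ranges.
Census BOOKKEEPING / STRUCTURE (seat pub-omega-stpp-1 gen 24, 2026-08-27), family (b2).  Nothing here is progress on `ω`:
every statement below is a necessary condition on STPP families in finite abelian groups, i.e. a tool for EXCLUDING
constructions.

## Contents

Let `(Aᵢ, Bᵢ, Cᵢ)_{i<N}` be an STPP family (CKSU 2005 Def. 5.1, the tree's `IsSTPP`) in a finite abelian group `H`, and (as in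
`STPPKneserFilter.lean` §2) `X = ⋃ᵢ (Bᵢ − Aᵢ)`, `Y = ⋃ᵢ (Cᵢ − Bᵢ)`, `Z = ⋃ᵢ (Cᵢ − Aᵢ)`.

* §1 Two counting functions and their bookkeeping: `rep X Y g = #{x ∈ X : g − x ∈ Y}` (number of representations
  `g = x + y`) and `dif Y δ = #{y ∈ Y : y − δ ∈ Y} = |Y ∩ (Y + δ)|`; pigeonhole `#X + #Y ≤ rep + |H|`, `2#Y ≤ dif + |H|`; double
  counting `Σ_g rep X Y g = #X·#Y`, `Σ_δ dif Y δ = #Y²`, and `Σ_{κ ∈ K} dif Y κ = Σ_{y ∈ Y} #{y' ∈ Y : y − y' ∈ K}`.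
* §2 The FIBRE BOUND (`fibre_bound`): for `K ∋ 0` closed under subtraction (a subgroup, e.g. a Kneser stabilizer) and
  `t(y)` the size of the `K`-coset fibre of `y` in `Y`, with `M = max t`:  `Σ_{y∈Y} t(y) ≤ M² + (#Y − M)·min(M, #Y − M)`.
* §3 **The representation count of an STPP family** (`rep_eq_card_B`): for `z ∈ Z_j`, `rep X Y z = |B_j|` EXACTLY — the
  solutions of `z = x + y` are `x = b − a'` (`b ∈ B_j`), by Def. 5.1 (ii) and the TPP of block `j`.  With the pigeonhole this
  is **filter N9**: `Σᵢ|Aᵢ||Bᵢ| + Σᵢ|Bᵢ||Cᵢ| ≤ |H| + |B_j|` for every `j` (`n9`), and its two rotations; a decidable card-vector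
  predicate `N9Dead n N a b c` with `not_isSTPP_of_n9Dead` (same shape as `N8Dead` / `not_isSTPP_of_n8Dead`).  N9 is strictly
  stronger than N5 (`stpp_sum_erase_card_mul_add_sum_card_mul_le`: `… ≤ |H| + |B_j||C_j|`) and, unlike N8, has no
  divisor quantifier.  Measured bite on the current fronts (HOME `pub-omega-stpp-1-g24/code/n9_filter.py`, numbers only): on the
  ℤ₅₇ front under N7+N8 (2 128 minimal undecided patterns) 4 are `N9Dead 57`; 35/212 ℤ₅₄ cores and 11/184 ℤ₅₅ cores (UNSAT
  records of the census) are `N9Dead`, i.e. get decide-free kernel certificates.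

The main customer is `STPP222NeverBeats.lean` (the cube non-beating theorem `8k ≤ |H|` for `(2,2,2)^k`), whose deficiency
analysis lives on `rep` / `dif` / `fibre_bound`.

References: H. Cohn, R. Kleinberg, B. Szegedy, C. Umans, FOCS 2005 (arXiv:math/0511460), Def. 5.1; M. B. Nathanson,
*Additive Number Theory: Inverse Problems*, GTM 165, §4.1 (stabilizers).
-/

open Finset
open scoped Pointwise

namespace Summit.MatrixMultiplication.OmegaCensus.CubeNB

variable {H : Type*} [AddCommGroup H] [DecidableEq H]

/-! ## §1 Counting functions -/


/-- Sum-representation count: `rep X Y g = #{x ∈ X : g − x ∈ Y} = |X ∩ (g − Y)|`, the number of ways to write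
`g = x + y` with `x ∈ X`, `y ∈ Y`. [folklore] -/
def rep (X Y : Finset H) (g : H) : ℕ := #(X.filter fun x => g - x ∈ Y)

/-- Difference-representation count: `dif Y δ = #{y ∈ Y : y − δ ∈ Y} = |Y ∩ (Y + δ)|`. [folklore] -/
def dif (Y : Finset H) (δ : H) : ℕ := #(Y.filter fun y => y - δ ∈ Y)

/-- `rep X Y g ≤ #X`. [folklore] -/
theorem rep_le_left (X Y : Finset H) (g : H) : rep X Y g ≤ #X := card_filter_le _ _

/-- The translate `g − Y` as an image; membership. [folklore] -/
theorem mem_image_sub_iff (Y : Finset H) (g x : H) : x ∈ Y.image (fun y => g - y) ↔ g - x ∈ Y := by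
  constructor
  · rintro hx
    obtain ⟨y, hy, rfl⟩ := mem_image.1 hx
    simpa using hy
  · intro hx
    exact mem_image.2 ⟨g - x, hx, by abel⟩

/-- `#(g − Y) = #Y`. [folklore] -/
theorem card_image_sub (Y : Finset H) (g : H) : #(Y.image fun y => g - y) = #Y :=
  card_image_of_injective _ (sub_right_injective)

/-- `X ∩ (g − Y)` is the filter defining `rep`. [folklore] -/
theorem filter_eq_inter_image (X Y : Finset H) (g : H) :
    X.filter (fun x => g - x ∈ Y) = X ∩ Y.image (fun y => g - y) := by
  ext x; simp only [mem_filter, mem_inter, mem_image_sub_iff]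

/-- `rep X Y g ≤ #Y`. [folklore] -/
theorem rep_le_right (X Y : Finset H) (g : H) : rep X Y g ≤ #Y := by
  rw [rep, filter_eq_inter_image, ← card_image_sub Y g]
  exact card_le_card inter_subset_right

/-- Pigeonhole: `#X + #Y ≤ rep X Y g + |H|`. [folklore] -/
theorem card_add_card_le_rep_add [Fintype H] (X Y : Finset H) (g : H) :
    #X + #Y ≤ rep X Y g + Fintype.card H := by
  rw [rep, filter_eq_inter_image, ← card_image_sub Y g]
  have h1 := card_union_add_card_inter X (Y.image fun y => g - y)
  have h2 : #(X ∪ Y.image fun y => g - y) ≤ Fintype.card H := card_le_univ _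
  omega

/-- Double counting: `Σ_g rep X Y g = #X · #Y`. [folklore] -/
theorem sum_rep [Fintype H] (X Y : Finset H) : ∑ g, rep X Y g = #X * #Y := by
  simp only [rep, card_filter]
  rw [sum_comm]
  have : ∀ x ∈ X, (∑ g : H, if g - x ∈ Y then 1 else 0) = #Y := by
    intro x _
    rw [← card_filter]
    have : (univ.filter fun g : H => g - x ∈ Y) = Y.image (fun y => y + x) := by
      ext g
      simp only [mem_filter, mem_univ, true_and, mem_image]
      constructor
      · intro hg; exact ⟨g - x, hg, by abel⟩
      · rintro ⟨y, hy, rfl⟩; simpa using hy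
    rw [this, card_image_of_injective _ (add_left_injective x)]
  rw [sum_congr rfl this, sum_const, smul_eq_mul]

/-- `dif Y 0 = #Y`. [folklore] -/
theorem dif_zero (Y : Finset H) : dif Y 0 = #Y := by
  simp [dif]

/-- `dif Y δ ≤ #Y`. [folklore] -/
theorem dif_le (Y : Finset H) (δ : H) : dif Y δ ≤ #Y := card_filter_le _ _

/-- `dif` as an intersection with a translate. [folklore] -/
theorem dif_eq_card_inter (Y : Finset H) (δ : H) :
    dif Y δ = #(Y ∩ Y.image (fun y => y + δ)) := by
  rw [dif]; congr 1; ext y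
  simp only [mem_filter, mem_inter, mem_image]
  constructor
  · rintro ⟨hy, h⟩; exact ⟨hy, y - δ, h, by abel⟩
  · rintro ⟨hy, y', hy', rfl⟩; exact ⟨hy, by simpa using hy'⟩

/-- Pigeonhole for `dif`: `2 #Y ≤ dif Y δ + |H|`. [folklore] -/
theorem two_mul_card_le_dif_add [Fintype H] (Y : Finset H) (δ : H) :
    2 * #Y ≤ dif Y δ + Fintype.card H := by
  rw [dif_eq_card_inter]
  have h1 := card_union_add_card_inter Y (Y.image fun y => y + δ)
  have h2 : #(Y ∪ Y.image fun y => y + δ) ≤ Fintype.card H := card_le_univ _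
  have h3 : #(Y.image fun y => y + δ) = #Y := card_image_of_injective _ (add_left_injective δ)
  omega

/-- Double counting: `Σ_δ dif Y δ = #Y²`. [folklore] -/
theorem sum_dif [Fintype H] (Y : Finset H) : ∑ δ, dif Y δ = #Y * #Y := by
  simp only [dif, card_filter]
  rw [sum_comm]
  have : ∀ y ∈ Y, (∑ δ : H, if y - δ ∈ Y then 1 else 0) = #Y := by
    intro y _
    rw [← card_filter]
    have : (univ.filter fun δ : H => y - δ ∈ Y) = Y.image (fun y' => y - y') := by
      ext δ
      simp only [mem_filter, mem_univ, true_and, mem_image]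
      constructor
      · intro h; exact ⟨y - δ, h, by abel⟩
      · rintro ⟨y', hy', rfl⟩; simpa using hy'
    rw [this, card_image_of_injective _ (sub_right_injective)]
  rw [sum_congr rfl this, sum_const, smul_eq_mul]

/-! ## §2 Stabilizers are closed under subtraction; the pair count and the fibre bound -/

section Fibre

/-- The stabilizer of a nonempty finset is closed under subtraction. [cite: Nathanson1996, §4.1] -/
theorem sub_mem_addStab {s : Finset H} (hs : s.Nonempty) {a b : H} (ha : a ∈ s.addStab) (hb : b ∈ s.addStab) :
    a - b ∈ s.addStab := by
  rw [Finset.mem_addStab hs] at ha hb ⊢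
  calc (a - b) +ᵥ s = (a - b) +ᵥ (b +ᵥ s) := by rw [hb]
    _ = (a - b + b) +ᵥ s := (add_vadd _ _ _).symm
    _ = s := by rw [sub_add_cancel, ha]

/-- Double counting: `Σ_{κ ∈ K} dif Y κ = Σ_{y ∈ Y} #{y' ∈ Y : y − y' ∈ K}`. [folklore] -/
theorem sum_dif_eq_sum_fibre (K Y : Finset H) :
    ∑ κ ∈ K, dif Y κ = ∑ y ∈ Y, #(Y.filter fun y' => y - y' ∈ K) := by
  simp only [dif, card_filter]
  rw [sum_comm]
  refine sum_congr rfl fun y _ => ?_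
  rw [← card_filter, ← card_filter]
  have : (Y.filter fun y' => y - y' ∈ K) = (K.filter fun κ => y - κ ∈ Y).image (fun κ => y - κ) := by
    ext y'
    simp only [mem_filter, mem_image]
    constructor
    · rintro ⟨hy', hK⟩; exact ⟨y - y', ⟨hK, by simpa using hy'⟩, by abel⟩
    · rintro ⟨κ, ⟨hκ, hY⟩, rfl⟩; exact ⟨hY, by simpa using hκ⟩
  rw [this, card_image_of_injective _ (sub_right_injective)]

/-- **Fibre bound.**  For `K ∋ 0` closed under subtraction (a subgroup) and `t(y) = #{y' ∈ Y : y − y' ∈ K}` (the size of the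
`K`-coset fibre of `y` in `Y`), with `M = max t`: `Σ_{y ∈ Y} t(y) ≤ M² + (#Y − M)·min(M, #Y − M)` and `M ≤ #K`, `M ≤ #Y`.
[folklore] -/
theorem fibre_bound (K Y : Finset H) (hsub : ∀ a ∈ K, ∀ b ∈ K, a - b ∈ K) (hYne : Y.Nonempty) :
    ∃ M, M ≤ #K ∧ M ≤ #Y ∧
      ∑ y ∈ Y, #(Y.filter fun y' => y - y' ∈ K) ≤ M * M + (#Y - M) * min M (#Y - M) := by
  set t : H → ℕ := fun y => #(Y.filter fun y' => y - y' ∈ K) with ht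
  obtain ⟨y₀, hy₀, hmax⟩ := exists_max_image Y t hYne
  set C₀ := Y.filter fun y' => y₀ - y' ∈ K with hC₀
  have hC₀Y : C₀ ⊆ Y := filter_subset _ _
  have hMC : t y₀ = #C₀ := rfl
  refine ⟨t y₀, ?_, card_filter_le _ _, ?_⟩
  · -- `M ≤ #K`
    calc t y₀ = #((Y.filter fun y' => y₀ - y' ∈ K).image fun y' => y₀ - y') :=
          (card_image_of_injective _ (sub_right_injective)).symm
      _ ≤ #K := card_le_card fun κ hκ => by
          obtain ⟨y', hy', rfl⟩ := mem_image.1 hκ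
          exact (mem_filter.1 hy').2
  · -- on `C₀` the fibre size is `M`; off `C₀` it is `≤ min M (#Y - M)`
    have hon : ∀ y ∈ C₀, t y = t y₀ := by
      intro y hy
      have hy0 : y₀ - y ∈ K := (mem_filter.1 hy).2
      show #(Y.filter fun y' => y - y' ∈ K) = #(Y.filter fun y' => y₀ - y' ∈ K)
      congr 1; ext y'
      simp only [mem_filter]
      refine and_congr_right fun _ => ⟨fun h => ?_, fun h => ?_⟩
      · have := hsub _ hy0 _ (hsub _ (hsub _ hy0 _ hy0) _ h)
        -- (y₀ - y) - (0 - (y - y')) = y₀ - y'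
        have e : y₀ - y - (y₀ - y - (y₀ - y) - (y - y')) = y₀ - y' := by abel
        rwa [e] at this
      · have := hsub _ h _ hy0
        have e : y₀ - y' - (y₀ - y) = y - y' := by abel
        rwa [e] at this
    have hoff : ∀ y ∈ Y \ C₀, t y ≤ min (t y₀) (#Y - t y₀) := by
      intro y hy
      rw [mem_sdiff] at hy
      refine le_min (hmax y hy.1) ?_
      rw [hMC, ← card_sdiff_of_subset hC₀Y]
      refine card_le_card fun y' hy' => ?_
      rw [mem_filter] at hy'
      rw [mem_sdiff]
      refine ⟨hy'.1, fun hy'C => hy.2 ?_⟩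
      rw [hC₀, mem_filter]
      refine ⟨hy.1, ?_⟩
      have := hsub _ (mem_filter.1 hy'C).2 _ hy'.2
      have e : y₀ - y' - (y - y') = y₀ - y := by abel
      rwa [e] at this
    have hsplit := sum_sdiff (f := t) hC₀Y
    have h1 : ∑ y ∈ C₀, t y = t y₀ * t y₀ := by
      rw [sum_congr rfl hon, sum_const, smul_eq_mul, hMC]
    have h2 : ∑ y ∈ Y \ C₀, t y ≤ #(Y \ C₀) * min (t y₀) (#Y - t y₀) := by
      rw [← smul_eq_mul]; exact sum_le_card_nsmul _ _ _ hoff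
    rw [card_sdiff_of_subset hC₀Y, ← hMC] at h2
    rw [← hsplit]
    linarith

end Fibre

/-! ## §3 The STPP interface: the representation count `= |B_j|` on `Z_j` and filter N9 -/

section STPP

open Literature.Computability.AlgebraicComplexity

variable {N : ℕ} {A B C : Fin N → Finset H}

/-- **Representation count.**  For an STPP family and `z ∈ Z_j = C_j − A_j`, the number of `x ∈ X = ⋃ᵢ(Bᵢ − Aᵢ)` with
`z − x ∈ Y = ⋃ₗ(Cₗ − Bₗ)` is EXACTLY `|B_j|` (the solutions are `x = b − a'`, `b ∈ B_j`, by CKSU Def. 5.1 (ii) and the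
TPP of block `j`). [cite: CohnKleinbergSzegedyUmans2005, Def. 5.1] -/
theorem rep_eq_card_B (hS : IsSTPP A B C) {j : Fin N} {z : H} (hz : z ∈ STPPKneser.D A C j) :
    rep (STPPKneser.DU A B univ) (STPPKneser.DU B C univ) z = #(B j) := by
  obtain ⟨a', ha', c', hc', rfl⟩ := STPPKneser.mem_D.1 hz
  have hset : (STPPKneser.DU A B univ).filter (fun x => c' - a' - x ∈ STPPKneser.DU B C univ) =
      (B j).image (fun b => b - a') := by
    ext x
    simp only [mem_filter, STPPKneser.DU, mem_biUnion, mem_univ, true_and, mem_image]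
    constructor
    · rintro ⟨⟨i, hx⟩, ⟨l, hy⟩⟩
      obtain ⟨a, ha, b, hb, rfl⟩ := STPPKneser.mem_D.1 hx
      obtain ⟨b'', hb'', c, hc, hy⟩ := STPPKneser.mem_D.1 hy
      have hrel : (a - a') + (b'' - b) + (c' - c) = 0 := by
        have : c - b'' = c' - a' - (b - a) := hy
        rw [← sub_eq_zero] at this
        rw [← neg_eq_zero, ← this]; abel
      obtain ⟨hil, hlj, haa, hbb, -⟩ := hS i l j a' ha' a ha b hb b'' hb'' c hc c' hc' hrel
      subst hil; subst hlj
      exact ⟨b, hb, by rw [haa]⟩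
    · rintro ⟨b, hb, rfl⟩
      refine ⟨⟨j, STPPKneser.mem_D.2 ⟨a', ha', b, hb, rfl⟩⟩, ⟨j, STPPKneser.mem_D.2 ⟨b, hb, c', hc', by abel⟩⟩⟩
  rw [rep, hset, card_image_of_injective _ (sub_left_injective)]

/-- **Filter N9 (representation-count pigeonhole), kernel.**  For an STPP family with non-empty sets in a finite abelian
group and every block `j`: `Σᵢ|Aᵢ||Bᵢ| + Σᵢ|Bᵢ||Cᵢ| ≤ |H| + |B_j|`.  (The rotations `(B,C,A)`, `(C,A,B)` give the versions with
`|C_j|`, `|A_j|` via `stpp_rotate`.)  Strictly stronger than N5 (`STPPDisjointPacking`), divisor-free unlike N8.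
[cite: CohnKleinbergSzegedyUmans2005, Def. 5.1] -/
theorem n9 [Fintype H] (hS : IsSTPP A B C) (hA : ∀ i, (A i).Nonempty) (hC : ∀ i, (C i).Nonempty) (j : Fin N) :
    ∑ i, #(A i) * #(B i) + ∑ i, #(B i) * #(C i) ≤ Fintype.card H + #(B j) := by
  obtain ⟨z, hz⟩ := STPPKneser.D_nonempty (E := A) (F := C) (hA j) (hC j)
  have h := card_add_card_le_rep_add (STPPKneser.DU A B univ) (STPPKneser.DU B C univ) z
  rw [rep_eq_card_B hS hz, STPPKneser.card_DU_AB hS hC, STPPKneser.card_DU_BC hS hA] at h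
  omega

/-- Filter N9, card-vector form, one reading: some block `j` has `S_AB + S_BC > n + b_j`. [folklore] -/
def N9Dead1 (n N : ℕ) (a b c : Fin N → ℕ) : Bool :=
  decide (∃ j : Fin N, n + b j < (∑ i, a i * b i) + ∑ i, b i * c i)

/-- Filter N9 on the card vectors: `N9Dead1` for one of the three rotations. [folklore] -/
def N9Dead (n N : ℕ) (a b c : Fin N → ℕ) : Bool := N9Dead1 n N a b c || N9Dead1 n N b c a || N9Dead1 n N c a b

/-- **Filter N9 (kernel): an STPP family with non-empty sets whose pattern is `N9Dead |H|` does not exist.**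
[cite: CohnKleinbergSzegedyUmans2005, Def. 5.1] -/
theorem not_isSTPP_of_n9Dead [Fintype H] (hS : IsSTPP A B C) (hA : ∀ i, (A i).Nonempty) (hB : ∀ i, (B i).Nonempty)
    (hC : ∀ i, (C i).Nonempty) {n : ℕ} (hn : Fintype.card H = n) {a b c : Fin N → ℕ} (ha : ∀ i, #(A i) = a i)
    (hb : ∀ i, #(B i) = b i) (hc : ∀ i, #(C i) = c i) (hdead : N9Dead n N a b c = true) : False := by
  simp only [N9Dead, Bool.or_eq_true, N9Dead1, decide_eq_true_eq] at hdead
  rcases hdead with (⟨j, hj⟩ | ⟨j, hj⟩) | ⟨j, hj⟩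
  · have := n9 hS hA hC j
    simp only [ha, hb, hc, hn] at this; omega
  · have := n9 (stpp_rotate hS) hB hA j
    simp only [ha, hb, hc, hn] at this; omega
  · have := n9 (stpp_rotate (stpp_rotate hS)) hC hB j
    simp only [ha, hb, hc, hn] at this; omega

/-- Literal card-vector form (non-emptiness from positivity of the entries). [folklore] -/
theorem not_isSTPP_of_n9Dead' [Fintype H] (hS : IsSTPP A B C) {n : ℕ} (hn : Fintype.card H = n)
    (a b c : Fin N → ℕ) (ha : ∀ i, #(A i) = a i) (hb : ∀ i, #(B i) = b i) (hc : ∀ i, #(C i) = c i)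
    (hpos : ∀ i, 0 < a i ∧ 0 < b i ∧ 0 < c i) (hdead : N9Dead n N a b c = true) : False :=
  not_isSTPP_of_n9Dead hS (fun i => card_pos.1 (by rw [ha]; exact (hpos i).1))
    (fun i => card_pos.1 (by rw [hb]; exact (hpos i).2.1)) (fun i => card_pos.1 (by rw [hc]; exact (hpos i).2.2))
    hn ha hb hc hdead

end STPP

end Summit.MatrixMultiplication.OmegaCensus.CubeNB
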